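import Summits.ResolutionOfSingularities.ResolutionOfSingularities.Theorems.DeltaCutStellarJetLaw
import Summits.ResolutionOfSingularities.ResolutionOfSingularities.Theorems.DeltaCutStellarJetModel
import HarnessLib

/-!
# DeltaCut classes, slice T19d-ii — KERNEL INHABITANT AND NON-INHABITANT of the jet class `ncHypShapeJet 2`

Route `MaxContactCut`, column `E1TopNoAbs`; lineage `decomp-res-lens-6` g35, WINDOW (a) («a kernel INHABITANT and a kernel
NON-INHABITANT among the three test data») and owed item (d) (kernel inhabitant of the wild-coprime binders).

On the coordinate model `Xs = Spec 𝔽₂[x₀,x₁,x₂]_{(x)}` (T19d-i `DeltaCutStellarJetModel`), frame `(H = V(x₀); x₁ : 3, x₂ : c)`,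
hypersurface `f_c = x₀² + x₁³·x₂ᶜ`, marked ideal `M c = (f_c~, 2)`:

* `ncHypShapeF_model c` — the unit-free NC-hyp shape (T17a) holds for every `c`; the one non-formal clause `Supp(M c) ⊆ V(x₀)` is
  proved with the derivation `∂/∂x₁` (`f ∈ 𝔭⁽²⁾ ⇒ ∂f = x₁²x₂ᶜ ∈ 𝔭 ⇒ x₀² ∈ 𝔭`); `pt_mem_support` — the closed point is a point of
  order `2` (NON-DEGENERATE support).
* **INHABITANT** `ncHypShapeJet_clean` (`c = 2`): this is the CLEAN TEST DATUM `x² + (1+z)z²w² = (x+zw)² + z³w²` of the critic ledger in the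
  coordinates `x₀ = x + zw, x₁ = z, x₂ = w` (frame `V(x+zw); z : 3, w : 2`).  The jet clause is NOT vacuous (`divPt_pt02`: the generic point
  of `V(x₀, x₂)` is `2`-divisible) and is met by the datum `(x₀, x₁x₂, x₁, ∂/∂x₁)` (`jetAt_clean`); hence `weakResolution_clean` by the
  T19b law — a kernel-checked weak resolution of the clean datum produced by the jet strategy.
* **INHABITANT of the wild-coprime class** `ncHypShapeCop_cop` (`c = 1`, labels `3, 1` odd): the owed datum `x² + z·w³` (`x₀ = x, x₁ = w,
  x₂ = z`), with `weakResolution_cop`.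
* **NON-INHABITANT** `not_jetAt_pt` / `not_ncHypShapeJet_kangaroo`: at the closed point NO jet datum exists for ANY ideal — every
  frame-logarithmic derivation maps `𝒪_pt` into `𝔪_pt` (residues `0, 1` only) — and on the KANGAROO frame `(V(x₀); x₁ : 2, x₂ : 2)` the
  closed point is `2`-divisible, so NO marked ideal is in the jet class there: this covers the kangaroo `x² + (1+xz)z²w²` and
  `x² + (1+x)z²w²` with their frames (frame-level exclusion; a cell-level exclusion over all frames is not claimed).
-/

open CategoryTheory AlgebraicGeometry Literature.AlgebraicGeometry.Resolution IsLocalRing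
open Summit.ResolutionOfSingularities.ResolutionOfSingularities.Theorems WeakOrderReduction ForcedTowerClasses

namespace Summit.ResolutionOfSingularities.ResolutionOfSingularities.Theorems.DeltaCutClasses

namespace JetModel

/-! ## The hypersurface models `x₀² + x₁³ x₂ᶜ` -/

/-- labels `(0, 3, c)` on `(D 0, D 1, D 2)`. -/
def lab (c : ℕ) : Fin 3 → ℕ := ![0, 3, c]

/-- Label of `H = D 0` is `0`. [folklore] -/
@[simp] theorem lab_zero (c : ℕ) : lab c 0 = 0 := rfl
/-- Label of `D 1` is `3`. [folklore] -/
@[simp] theorem lab_one (c : ℕ) : lab c 1 = 3 := rfl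
/-- Label of `D 2` is `c`. [folklore] -/
@[simp] theorem lab_two (c : ℕ) : lab c 2 = c := rfl

/-- `f_c = x₀² + x₁³ x₂ᶜ`. -/
noncomputable abbrev f (c : ℕ) : S := x 0 ^ 2 + x 1 ^ 3 * x 2 ^ c

/-- the marked ideal `(f_c~, 2)`. -/
noncomputable def M (c : ℕ) : MarkedIdeal Xs := ⟨affineBlowup.idealSheaf (Ideal.span {f c}), [], 2⟩

/-- The ideal of the test datum is `(x 0 ^ 2 + x 1 ^ 3 * x 2 ^ c)`. [folklore] -/
theorem M_ideal (c : ℕ) : (M c).ideal = affineBlowup.idealSheaf (Ideal.span {f c}) := rfl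

/-- The marking of the test datum is `2`. [folklore] -/
theorem M_mult (c : ℕ) : (M c).mult = 2 := rfl

/-- The frame monomial of the labels `lab c` is `x 1 ^ 3 * x 2 ^ c`. [folklore] -/
theorem prod_lab (c : ℕ) : ∏ j, x j ^ lab c j = x 1 ^ 3 * x 2 ^ c := by
  simp [Fin.prod_univ_three]

/-- The monomial ideal sheaf of `frame (lab c)` is `(x 1 ^ 3 * x 2 ^ c)`. [folklore] -/
theorem monomialIdeal_lab (c : ℕ) :
    monomialIdeal (frame (lab c)) = affineBlowup.idealSheaf (Ideal.span {x 1 ^ 3 * x 2 ^ c}) := by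
  rw [monomialIdeal_frame, prod_lab]

/-- **`Supp(f_c~, 2) ⊆ V(x₀)`** — via `∂/∂x₁`: `f ∈ 𝔪_𝔭²𝒪_𝔭 ⇒ ∂f = x₁²x₂ᶜ ∈ 𝔭 ⇒ x₁³x₂ᶜ ∈ 𝔭 ⇒ x₀² = f − x₁³x₂ᶜ ∈ 𝔭`. [folklore] -/
theorem support_M_subset (c : ℕ) : ((M c).support : Set Xs) ⊆ H.support := by
  intro p hp
  have hle : stalkIdeal (M c).ideal p ≤ maximalIdeal _ ^ 2 := (MarkedIdeal.mem_support_iff (M c) p).mp hp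
  rw [M_ideal, stalkIdeal_span] at hle
  have hf2 : φ p (f c) ∈ maximalIdeal _ ^ 2 := hle (Ideal.mem_span_singleton_self _)
  have hf1 : f c ∈ p.asIdeal := (mem_maximalIdeal_iff p (f c)).mp (Ideal.pow_le_self two_ne_zero hf2)
  obtain ⟨δ, hδ, -, hδf⟩ := exists_isDeriv_stalk p
  have h12 : x 1 ^ 2 * x 2 ^ c ∈ p.asIdeal := by
    rw [← mem_maximalIdeal_iff p, ← hδf c]
    exact hδ.apply_mem_of_mem_sq _ hf2
  have h12' : x 1 ^ 3 * x 2 ^ c ∈ p.asIdeal := by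
    rcases p.2.mem_or_mem h12 with h | h
    · exact p.asIdeal.mul_mem_right _ (p.asIdeal.pow_mem_of_mem (p.2.mem_of_pow_mem 2 h) 3 (by norm_num))
    · exact p.asIdeal.mul_mem_left _ h
  have hx0 : x 0 ^ 2 ∈ p.asIdeal := by
    have := p.asIdeal.sub_mem hf1 h12'
    rwa [add_sub_cancel_right] at this
  exact (mem_support_D 0 p).mpr (p.2.mem_of_pow_mem 2 hx0)

/-- **the unit-free NC-hyp shape (T17a) of the model**, any `c`. -/
theorem ncHypShapeF_model (c : ℕ) : ncHypShapeF 2 Xs (frame (lab c)) H (M c) := by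
  refine ⟨rfl, fun q hq hqH => ?_, fun y _ => ?_, support_M_subset c⟩
  · obtain ⟨j, rfl⟩ := (List.mem_ofFn' _ _).mp hq
    have hj : j = 0 := D_injective hqH
    subst hj
    exact Or.inl rfl
  · refine ⟨φ y (x 0), φ y (x 1 ^ 3 * x 2 ^ c), 1, isUnit_one, stalkIdeal_span _ _, ?_, ?_⟩
    · rw [monomialIdeal_lab, stalkIdeal_span]
    · rw [M_ideal, stalkIdeal_span, one_mul, ← map_pow, ← map_add]

/-- `2 = 0` in every stalk. -/
theorem two_eq_zero_stalk (y : Xs) : ((2 : ℕ) : Xs.presheaf.stalk y) = 0 := by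
  rw [← map_natCast (φ y) 2, Nat.cast_ofNat, two_eq_zero, map_zero]

/-- **non-degeneracy**: the closed point is a point of order `2` of `f_c` (`c ≥ 1`), i.e. `pt ∈ Supp(M c)`. -/
theorem pt_mem_support (c : ℕ) (hc : 1 ≤ c) : pt ∈ (M c).support := by
  rw [MarkedIdeal.mem_support_iff, M_ideal, stalkIdeal_span, M_mult, Ideal.span_le, Set.singleton_subset_iff,
    SetLike.mem_coe, maximalIdeal_stalk_eq, pt_asIdeal, ← Ideal.map_pow]
  refine Ideal.mem_map_of_mem _ ?_
  rw [pow_two]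
  refine Ideal.add_mem _ (by rw [pow_two]; exact Ideal.mul_mem_mul (x_mem 0) (x_mem 0)) ?_
  obtain ⟨c, rfl⟩ := Nat.exists_eq_add_of_le' hc
  rw [pow_succ (x 2) c, ← mul_assoc]
  exact Ideal.mul_mem_mul (Ideal.mul_mem_right _ _ (Ideal.pow_mem_of_mem _ (x_mem 1) 3 (by norm_num))) (x_mem 2)

/-! ## The clean datum (`c = 2`): INHABITANT of the jet class -/

/-- a `2`-divisible point of the clean frame lies off `V(x₁)` (label `3` is odd). -/
theorem x_one_notMem_of_divPt {y : Xs} (hd : DivPt 2 (frame (lab 2)) y) : x 1 ∉ y.asIdeal := fun h1 => by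
  have h := hd.1 (D 1) ((mem_support_D 1 y).mpr h1)
  rw [expOf_frame, lab_one] at h
  omega

/-- **THE JET DATUM `(x₀, x₁x₂, x₁, ∂/∂x₁)`** at every point of `V(x₀)` off `V(x₁)`. -/
theorem jetAt_clean {y : Xs} (hy1 : x 1 ∉ y.asIdeal) : JetAt 2 (frame (lab 2)) H (M 2).ideal y := by
  obtain ⟨δ, hδ, hδx, -⟩ := exists_isDeriv_stalk y
  refine ⟨φ y (x 0), φ y (x 1 * x 2), φ y (x 1), δ, hδ, stalkIdeal_span _ _, ?_, ?_, ?_, ?_⟩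
  · rw [monomialIdeal_lab, stalkIdeal_span]
    obtain ⟨u, hu⟩ := (isUnit_iff y (x 1)).mpr hy1
    refine Ideal.mem_span_singleton'.mpr ⟨↑u⁻¹, ?_⟩
    have : φ y (x 1 ^ 3 * x 2 ^ 2) = φ y (x 1) * φ y (x 1 * x 2) ^ 2 := by
      simp only [map_pow, map_mul]; ring
    rw [this, ← hu, ← mul_assoc, Units.inv_mul, one_mul]
  · rw [M_ideal, stalkIdeal_span]
    have : φ y (x 0) ^ 2 + φ y (x 1) * φ y (x 1 * x 2) ^ 2 = φ y (f 2) := by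
      simp only [map_add, map_mul, map_pow]; ring
    rw [this]
    exact Ideal.mem_span_singleton_self _
  · intro K hK hyK g hg
    obtain ⟨j, rfl⟩ := (mem_cons_boundaryOf_frame_iff (lab 2)).mp hK
    rw [stalkIdeal_span] at hg ⊢
    refine hδ.apply_mem_span_singleton_of_log ?_ hg
    by_cases hj : j = 1
    · subst hj
      exact absurd ((mem_support_D 1 y).mp hyK) hy1
    · rw [hδx, if_neg hj]
      exact Ideal.zero_mem _
  · rw [hδx, if_pos rfl]
    exact isUnit_one

/-- **THE KERNEL INHABITANT (window (a)).** The clean datum `x₀² + x₁³x₂²` — `= x² + (1+z)z²w²` in the coordinates `x₀ = x + zw`,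
`x₁ = z`, `x₂ = w` — framed by `(V(x₀); x₁ : 3, x₂ : 2)` on `Spec 𝔽₂[x]_{(x)}` IS in the jet class `ncHypShapeJet 2`. -/
theorem ncHypShapeJet_clean : ncHypShapeJet 2 Xs (frame (lab 2)) H (M 2) :=
  ⟨ncHypShapeF_model 2, Nat.prime_two, two_eq_zero_stalk, fun _ _ hd => jetAt_clean (x_one_notMem_of_divPt hd)⟩

/-- … its frame is s.n.c. with `H` a member, its support contains the closed point (order `2` there) … -/
theorem clean_nondegenerate :
    HasSNC (H :: boundaryOf (frame (lab 2))) ∧ H ∈ boundaryOf (frame (lab 2)) ∧ pt ∈ (M 2).support :=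
  ⟨hasSNC_frame _, H_mem_boundaryOf_frame _, pt_mem_support 2 (by norm_num)⟩

/-- the generic point `pt02` of the curve `V(x₀, x₂)`. -/
noncomputable def pt02 : Xs :=
  (⟨Ideal.span (x '' (({0, 2} : Finset (Fin 3)) : Set (Fin 3))), isPrime_span_image spanFinrank_S x span_range_x {0, 2}⟩ :
    PrimeSpectrum S)

/-- … and the jet clause is NOT vacuous: `pt02 ∈ V(H)` is a `2`-divisible point of the clean frame. -/
theorem divPt_pt02 : pt02 ∈ H.support ∧ DivPt 2 (frame (lab 2)) pt02 := by
  have h0 : x 0 ∈ pt02.asIdeal := Ideal.subset_span ⟨0, by simp, rfl⟩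
  have h2 : x 2 ∈ pt02.asIdeal := Ideal.subset_span ⟨2, by simp, rfl⟩
  have h1 : x 1 ∉ pt02.asIdeal := x_one_notMem_span
  refine ⟨(mem_support_D 0 _).mpr h0, fun K hK => ?_, ⟨D 2, (mem_support_D 2 _).mpr h2, by rw [expOf_frame, lab_two]; decide⟩⟩
  by_cases hj : ∃ j, D j = K
  · obtain ⟨j, rfl⟩ := hj
    rw [expOf_frame]
    have hj1 : j ≠ 1 := by
      rintro rfl
      exact h1 ((mem_support_D 1 _).mp hK)
    have : ∀ j : Fin 3, j ≠ 1 → 2 ∣ lab 2 j := by decide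
    exact this j hj1
  · rw [expOf_frame_eq_zero (lab 2) fun j h => hj ⟨j, h⟩]
    exact dvd_zero 2

/-- ★ **THE JET CLAUSE IS EXERCISED (not vacuous) on the clean datum**: a `2`-divisible point of `V(H)` carrying a jet datum. [new] -/
theorem exists_divPt_jetAt_clean :
    ∃ y ∈ H.support, DivPt 2 (frame (lab 2)) y ∧ JetAt 2 (frame (lab 2)) H (M 2).ideal y :=
  ⟨pt02, divPt_pt02.1, divPt_pt02.2, jetAt_clean (x_one_notMem_of_divPt divPt_pt02.2)⟩

/-- the closed point itself is NOT `2`-divisible on the clean frame (label `3` through it): the jet clause exempts it. -/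
theorem not_divPt_pt_clean : ¬ DivPt 2 (frame (lab 2)) pt := fun hd =>
  x_one_notMem_of_divPt hd (x_mem 1)

/-- **A WEAK RESOLUTION OF THE CLEAN DATUM, by the jet law (T19b).** -/
theorem weakResolution_clean : ∃ s : CentreSeq Xs, WeakResolution s (M 2) :=
  exists_weakResolution_of_ncHypShapeJet (hasSNC_frame _) (H_mem_boundaryOf_frame _) (M 2) ncHypShapeJet_clean

/-! ## The owed datum `x² + z·w³` (`c = 1`): INHABITANT of the wild-coprime class (T18) -/

/-- **THE KERNEL INHABITANT of the wild-coprime binders (owed item (d)).** `x₀² + x₁³x₂` (`= x² + w³z`, `x₁ = w`, `x₂ = z`) framed by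
`(V(x₀); x₁ : 3, x₂ : 1)` on `Spec 𝔽₂[x]_{(x)}` is in `ncHypShapeCop 2` (labels odd). -/
theorem ncHypShapeCop_cop : ncHypShapeCop 2 Xs (frame (lab 1)) H (M 1) := by
  refine ⟨ncHypShapeF_model 1, Nat.prime_two, two_eq_zero_stalk, fun K y _ => ?_⟩
  by_cases hj : ∃ j, D j = K
  · obtain ⟨j, rfl⟩ := hj
    rw [expOf_frame]
    have : ∀ j : Fin 3, lab 1 j = 0 ∨ ¬ 2 ∣ lab 1 j := by decide
    exact this j
  · exact Or.inl (expOf_frame_eq_zero (lab 1) fun j h => hj ⟨j, h⟩)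

/-- The coprime test datum `x 0 ^ 2 + x 1 ^ 3 * x 2` (the owed `x² + z·w³` over `𝔽₂`, frame `z : 3`, `w : 1`) is NON-degenerate:
s.n.c. frame through `H`, `H` a member of it, and the closed point lies in the support. [new] -/
theorem cop_nondegenerate :
    HasSNC (H :: boundaryOf (frame (lab 1))) ∧ H ∈ boundaryOf (frame (lab 1)) ∧ pt ∈ (M 1).support :=
  ⟨hasSNC_frame _, H_mem_boundaryOf_frame _, pt_mem_support 1 le_rfl⟩

/-- **a weak resolution of `x² + z·w³`**, by `Cop ⊆ Jet` (T19b) and the jet law. -/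
theorem weakResolution_cop : ∃ s : CentreSeq Xs, WeakResolution s (M 1) :=
  exists_weakResolution_of_ncHypShapeJet (hasSNC_frame _) (H_mem_boundaryOf_frame _) (M 1) ncHypShapeCop_cop.toJet

/-- **The jet cell STRICTLY enlarges g34's coprime cell, witnessed in kernel:** the clean datum (in `ncHypShapeJet 2`,
`ncHypShapeJet_clean`) is NOT in `ncHypShapeCop 2` — its member `D 2` has the `2`-divisible label `2` and passes through the
closed point. [new] -/
theorem not_ncHypShapeCop_clean : ¬ ncHypShapeCop 2 Xs (frame (lab 2)) H (M 2) := by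
  rintro ⟨-, -, -, hcop⟩
  rcases hcop (D 2) pt (pt_mem_support_D 2) with h | h
  · rw [expOf_frame] at h
    exact absurd h (by decide)
  · rw [expOf_frame] at h
    exact h (by decide)

/-! ## The kangaroo frame: NON-INHABITANT -/

/-- **NO JET DATUM AT THE CLOSED POINT, for any ideal and any labels.** Every frame-logarithmic derivation `δ` of
`𝒪_pt = 𝔽₂[x]_{(x)}` preserves `𝔪_pt = (x₀, x₁, x₂)` and kills the residues `0, 1`, so `δ(𝒪_pt) ⊆ 𝔪_pt` and `δ r` is never a
unit. [folklore] -/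
theorem not_jetAt_pt (a : Fin 3 → ℕ) (I : Xs.IdealSheafData) : ¬ JetAt 2 (frame a) H I pt := by
  rintro ⟨h, m₀, r, δ, hδ, -, -, -, hlog, hunit⟩
  have hlogj : ∀ j, δ (φ pt (x j)) ∈ Ideal.span {φ pt (x j)} := fun j => by
    have := hlog (D j) ((mem_cons_boundaryOf_frame_iff a).mpr ⟨j, rfl⟩) (pt_mem_support_D j) (φ pt (x j))
      (by rw [stalkIdeal_span]; exact Ideal.mem_span_singleton_self _)
    rwa [stalkIdeal_span] at this
  have hstab : ∀ g ∈ maximalIdeal (Xs.presheaf.stalk pt), δ g ∈ maximalIdeal (Xs.presheaf.stalk pt) := by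
    intro g hg
    rw [maximalIdeal_pt_eq] at hg ⊢
    exact hδ.apply_mem_span_range_of_log (fun j => φ pt (x j)) hlogj hg
  have hr : δ r ∈ maximalIdeal (Xs.presheaf.stalk pt) := by
    rcases stalk_mem_or_sub_one_mem r with h | h
    · exact hstab r h
    · have : δ r = δ (r - 1) := by rw [hδ.map_sub, hδ.map_one, sub_zero]
      rw [this]
      exact hstab _ h
  exact (IsLocalRing.mem_maximalIdeal _).mp hr hunit

/-- kangaroo labels `(0, 2, 2)`: the frames of `x² + (1+xz)z²w²` and `x² + (1+x)z²w²` at the origin (`x₀ = x, x₁ = z, x₂ = w`). -/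
def kangaroo : Fin 3 → ℕ := ![0, 2, 2]

/-- on the kangaroo frame the closed point IS `2`-divisible … -/
theorem divPt_pt_kangaroo : DivPt 2 (frame kangaroo) pt := by
  refine ⟨fun K _ => ?_, ⟨D 1, pt_mem_support_D 1, by rw [expOf_frame]; decide⟩⟩
  by_cases hj : ∃ j, D j = K
  · obtain ⟨j, rfl⟩ := hj
    rw [expOf_frame]
    have : ∀ j : Fin 3, 2 ∣ kangaroo j := by decide
    exact this j
  · rw [expOf_frame_eq_zero kangaroo fun j h => hj ⟨j, h⟩]
    exact dvd_zero 2

/-- **THE KERNEL NON-INHABITANT (window (a)).** NO marked ideal on `Spec 𝔽₂[x]_{(x)}` framed by the kangaroo frame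
`(V(x₀); x₁ : 2, x₂ : 2)` is in the jet class — in particular not the kangaroo `x₀² + (1+x₀x₁)x₁²x₂²` and not `x₀² + (1+x₀)x₁²x₂²`. -/
theorem not_ncHypShapeJet_kangaroo (N : MarkedIdeal Xs) : ¬ ncHypShapeJet 2 Xs (frame kangaroo) H N :=
  fun hP => not_jetAt_pt kangaroo N.ideal (hP.2.2.2 pt (pt_mem_support_D 0) divPt_pt_kangaroo)

end JetModel

end Summit.ResolutionOfSingularities.ResolutionOfSingularities.Theorems.DeltaCutClasses
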